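import Mathlib
import Summits.MatrixMultiplication.MatrixMultiplication.Theorems.FourierTwoFamiliesModPPrimeTwoFamiliesLadderLexProd

/-!
# Lexicographic products of cyclic ladders live in cyclic hosts (support file)

Item `stmt-MatrixMultiplication-14308` (`FourierTwoFamiliesModP.PrimeTwoFamilies`: CKSU 2005, Conj. 4.7
with prime cyclic hosts), line `Sketch`, on top of the landed stub `LadderLift.isLadder_lexProd`
(file `FourierTwoFamiliesModPPrimeTwoFamiliesLadderLexProd.lean`).

A LADDER in an abelian group `G` is an ordered family `(X c, Y c)_{c < r}` of finite subsets with

* (directness, `hW`) every class is direct: `(x - x') + (y - y') = 0` with `x, x' ∈ X c`,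
  `y, y' ∈ Y c` forces `x = x'` and `y = y'`;
* (one-directional separation, `hL`) for `p < q` no lower cross difference `y' - x'`
  (`x' ∈ X p`, `y' ∈ Y q`) equals a diagonal difference `y - x` (`x ∈ X c`, `y ∈ Y c`).

`LadderLift.isLadder_lexProd` shows that the lexicographic product of a ladder in `G₁` and a ladder in
`G₂` (classes `X₁ c.divNat ×ˢ X₂ c.modNat`, `Y₁ c.divNat ×ˢ Y₂ c.modNat`, `c : Fin (r₁ * r₂)`) is a ladder
in `G₁ × G₂`.  Its registration note anticipates the use: "with coprime moduli the product host is cyclic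
(`ZMod.chineseRemainder`)".  This file supplies exactly that step, in the clause shape of the cyclic
ladder form of the crux (`LadderLift.primeTwoFamilies_iff_cyclicLadder`, hosts `ZMod m`):

* `isLadder_map` — both ladder clauses are equational, so they transport along any injective additive
  map (`AddMonoidHomClass`; classwise `Finset.image`);
* `exists_isLadder_zmod_mul` — for coprime `m₁, m₂`, ladders with `r₁` classes in `ZMod m₁` and `r₂`
  classes in `ZMod m₂` give a ladder with `r₁ * r₂` classes in the CYCLIC group `ZMod (m₁ * m₂)` whose
  class sizes are the products of the factor class sizes (lexicographic product transported along the
  inverse Chinese remainder isomorphism).  So class number, class sizes and modulus are simultaneously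
  multiplicative inside the cyclic ladder form: the merit of a finite ladder alphabet is
  super-multiplicative without leaving cyclic hosts.

Mathlib + the landed stub only; no new definitions.
-/

-- single-conjunct summit: the mandated namespace repeats `MatrixMultiplication` (summit = sub-problem).
set_option linter.dupNamespace false

namespace Summit.MatrixMultiplication.MatrixMultiplication.Theorems.PrimeTwoFamilies.LadderLift

/-- **Transport.**  Both ladder clauses are preserved under an injective additive map `f : G → H`
(any `AddMonoidHomClass`, e.g. an additive or ring isomorphism): the classwise images
`(X c).image f, (Y c).image f` of a ladder form a ladder.  Directness pulls back because
`f ((x - x') + (y - y')) = (f x - f x') + (f y - f y')` and `f` is injective; separation likewise. -/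
theorem isLadder_map {G H F : Type*} [AddCommGroup G] [AddCommGroup H] [DecidableEq H]
    [FunLike F G H] [AddMonoidHomClass F G H] (f : F) (hf : Function.Injective f) {r : ℕ}
    (X Y : Fin r → Finset G)
    (hW : ∀ c : Fin r, ∀ x ∈ X c, ∀ x' ∈ X c, ∀ y ∈ Y c, ∀ y' ∈ Y c,
      (x - x') + (y - y') = 0 → x = x' ∧ y = y')
    (hL : ∀ c p q : Fin r, p < q → ∀ x ∈ X c, ∀ y ∈ Y c, ∀ x' ∈ X p, ∀ y' ∈ Y q,
      y - x ≠ y' - x') :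
    (∀ c : Fin r, ∀ x ∈ (X c).image f, ∀ x' ∈ (X c).image f, ∀ y ∈ (Y c).image f,
        ∀ y' ∈ (Y c).image f, (x - x') + (y - y') = 0 → x = x' ∧ y = y') ∧
    (∀ c p q : Fin r, p < q → ∀ x ∈ (X c).image f, ∀ y ∈ (Y c).image f,
        ∀ x' ∈ (X p).image f, ∀ y' ∈ (Y q).image f, y - x ≠ y' - x') := by
  refine ⟨fun c x hx x' hx' y hy y' hy' h => ?_, fun c p q hpq x hx y hy x' hx' y' hy' h => ?_⟩
  · simp only [Finset.mem_image] at hx hx' hy hy'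
    obtain ⟨a, ha, rfl⟩ := hx
    obtain ⟨a', ha', rfl⟩ := hx'
    obtain ⟨b, hb, rfl⟩ := hy
    obtain ⟨b', hb', rfl⟩ := hy'
    have h' : f ((a - a') + (b - b')) = f 0 := by
      rw [map_add, map_sub, map_sub, map_zero]
      exact h
    obtain ⟨h₁, h₂⟩ := hW c a ha a' ha' b hb b' hb' (hf h')
    exact ⟨congrArg f h₁, congrArg f h₂⟩
  · simp only [Finset.mem_image] at hx hx' hy hy'
    obtain ⟨a, ha, rfl⟩ := hx
    obtain ⟨b, hb, rfl⟩ := hy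
    obtain ⟨a', ha', rfl⟩ := hx'
    obtain ⟨b', hb', rfl⟩ := hy'
    refine hL c p q hpq a ha b hb a' ha' b' hb' (hf ?_)
    rw [map_sub, map_sub]
    exact h

/-- **Cyclic hosts.**  For coprime moduli `m₁, m₂`, a ladder with `r₁` classes in `ZMod m₁` and a ladder
with `r₂` classes in `ZMod m₂` give a ladder with `r₁ * r₂` classes in the CYCLIC group `ZMod (m₁ * m₂)`
whose `c`-th classes have exactly `|X₁ c.divNat| * |X₂ c.modNat|` and `|Y₁ c.divNat| * |Y₂ c.modNat|`
elements: the lexicographic product (`isLadder_lexProd`) transported (`isLadder_map`) along the inverse of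
the Chinese remainder isomorphism `ZMod (m₁ * m₂) ≃+* ZMod m₁ × ZMod m₂`.  So in the cyclic ladder form
of the crux, class number, class sizes and modulus are simultaneously multiplicative. -/
theorem exists_isLadder_zmod_mul {m₁ m₂ : ℕ} (hm : m₁.Coprime m₂) {r₁ r₂ : ℕ}
    (X₁ Y₁ : Fin r₁ → Finset (ZMod m₁)) (X₂ Y₂ : Fin r₂ → Finset (ZMod m₂))
    (hW₁ : ∀ c : Fin r₁, ∀ x ∈ X₁ c, ∀ x' ∈ X₁ c, ∀ y ∈ Y₁ c, ∀ y' ∈ Y₁ c,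
      (x - x') + (y - y') = 0 → x = x' ∧ y = y')
    (hL₁ : ∀ c p q : Fin r₁, p < q → ∀ x ∈ X₁ c, ∀ y ∈ Y₁ c, ∀ x' ∈ X₁ p, ∀ y' ∈ Y₁ q,
      y - x ≠ y' - x')
    (hW₂ : ∀ c : Fin r₂, ∀ x ∈ X₂ c, ∀ x' ∈ X₂ c, ∀ y ∈ Y₂ c, ∀ y' ∈ Y₂ c,
      (x - x') + (y - y') = 0 → x = x' ∧ y = y')
    (hL₂ : ∀ c p q : Fin r₂, p < q → ∀ x ∈ X₂ c, ∀ y ∈ Y₂ c, ∀ x' ∈ X₂ p, ∀ y' ∈ Y₂ q,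
      y - x ≠ y' - x') :
    ∃ X Y : Fin (r₁ * r₂) → Finset (ZMod (m₁ * m₂)),
      (∀ c : Fin (r₁ * r₂), ∀ x ∈ X c, ∀ x' ∈ X c, ∀ y ∈ Y c, ∀ y' ∈ Y c,
          (x - x') + (y - y') = 0 → x = x' ∧ y = y') ∧
      (∀ c p q : Fin (r₁ * r₂), p < q → ∀ x ∈ X c, ∀ y ∈ Y c, ∀ x' ∈ X p, ∀ y' ∈ Y q,
          y - x ≠ y' - x') ∧
      ∀ c : Fin (r₁ * r₂), (X c).card = (X₁ c.divNat).card * (X₂ c.modNat).card ∧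
        (Y c).card = (Y₁ c.divNat).card * (Y₂ c.modNat).card := by
  obtain ⟨hW, hL⟩ := isLadder_lexProd X₁ Y₁ X₂ Y₂ hW₁ hL₁ hW₂ hL₂
  have hinj := (ZMod.chineseRemainder hm).symm.injective
  obtain ⟨hW', hL'⟩ := isLadder_map (ZMod.chineseRemainder hm).symm hinj
    (fun c : Fin (r₁ * r₂) => X₁ c.divNat ×ˢ X₂ c.modNat)
    (fun c : Fin (r₁ * r₂) => Y₁ c.divNat ×ˢ Y₂ c.modNat) hW hL
  refine ⟨fun c => (X₁ c.divNat ×ˢ X₂ c.modNat).image (ZMod.chineseRemainder hm).symm,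
    fun c => (Y₁ c.divNat ×ˢ Y₂ c.modNat).image (ZMod.chineseRemainder hm).symm, hW', hL',
    fun c => ⟨?_, ?_⟩⟩
  · rw [Finset.card_image_of_injective _ hinj, Finset.card_product]
  · rw [Finset.card_image_of_injective _ hinj, Finset.card_product]

end Summit.MatrixMultiplication.MatrixMultiplication.Theorems.PrimeTwoFamilies.LadderLift
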